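import Literature.AlgebraicGeometry.Resolution.AffineBlowupAlgebra
import Literature.AlgebraicGeometry.Resolution.BlowupAlgebraStrictTransform
import Mathlib.RingTheory.TensorProduct.MvPolynomial
import Mathlib.RingTheory.MvPolynomial.Localization
import Mathlib.RingTheory.Localization.FractionRing
import Mathlib.RingTheory.Flat.Basic
import Mathlib.LinearAlgebra.FreeModule.Basic
import HarnessLib

/-!
# The chart of a blowing up after a base change `A → B` of "fraction type" (e.g. `K ↦ K(t)`)

Support file for crux stmt-ResolutionOfSingularities-15960
(`SectionAscent.FibrewiseClosedPoints`, line `registered`, stub `stub_certificateRegular`).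

Abstract setting: a field `K`, a `K`-algebra `A`, a commutative ring `B` with ring maps
`ι : A → B` and `τ : K[t₁, …, t_s] → B` such that `Φ : A[t] → B` (`x ↦ ι x`, `t_j ↦ τ t_j`) is
injective and every `b ∈ B` satisfies `b · τ(q) = Φ(F)` for some non-zero `q ∈ K[t]`
(`B = K(t) ⊗_K A` is the case in point: `tensor_baseChange_hypotheses`). For an ideal `I ∋ a`
the affine blowup algebra `B[IB/ι(a)] ⊆ B[1/ι(a)]` receives `(A[It])_{(at)}[t]` by the ring map
`χ` with `χ(c) = (A[It])_{(at)} ≅ A[I/a] → B[IB/ι(a)]` on coefficients and `χ(t_j) = τ(t_j)/1`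
(a variable pinned down by these values). We prove that `χ` is INJECTIVE
(`chartPolyMap_injective`, localizing `Φ` at `a`) and that every element `f` of `B[IB/ι(a)]`
satisfies `f · χ(σ) = χ(d)` for a non-zero scalar `σ ∈ K[t]` (`exists_mul_chartPolyMap_eq`):
`B[IB/ι(a)]` is the localization `K(t) ⊗_K A[I/a]` of `A[I/a][t]` — blowing up commutes with the
flat base change `K → K(t)` (Stacks 0805) in the form needed. For `B = K(t) ⊗_K A` the two
hypotheses are verified in `tensor_baseChange_hypotheses` (`A[t] → K(t) ⊗_K A` is injective by
flatness of `A` over the field `K`). No definitions are introduced.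

References: The Stacks Project, Tag 0805 (blowing up commutes with flat base change) and
Tag 0804 (affine blowup algebras); everything below is folklore.
-/

-- single-problem summit: the doubled namespace component is forced
set_option linter.dupNamespace false

noncomputable section

namespace Summit.ResolutionOfSingularities.ResolutionOfSingularities.Theorems.SectionAscent.CertificateRegular

open MvPolynomial TensorProduct Literature.AlgebraicGeometry.Resolution

universe u

/-! ## The concrete base change `B = K(t) ⊗_K A` -/

section Tensor

variable (K A : Type u) [Field K] [CommRing A] [Algebra K A] (s : ℕ)

/-- **`B = K(t₁, …, t_s) ⊗_K A` satisfies the base-change hypotheses**: with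
`ι = (x ↦ 1 ⊗ x)`, `τ = (p ↦ p ⊗ 1)`, (1) `ι(k) = τ(k)` for `k ∈ K`; (2) `τ(q)` is a unit for
`q ≠ 0`; (3) `Φ : A[t] → B` is injective (it is `A[t] ≅ K[t] ⊗_K A → K(t) ⊗_K A`, injective by
flatness of `A` over the field `K`); (4) every `b ∈ B` has `b · τ(q) = Φ(F)` for some `q ≠ 0`
(`b = Σ (p_i/q) ⊗ x_i`). [folklore] -/
theorem tensor_baseChange_hypotheses
    (ι : A →+* TensorProduct K (FractionRing (MvPolynomial (Fin s) K)) A)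
    (τ : MvPolynomial (Fin s) K →+* TensorProduct K (FractionRing (MvPolynomial (Fin s) K)) A)
    (hι : ∀ r : A, ι r = (1 : FractionRing (MvPolynomial (Fin s) K)) ⊗ₜ[K] r)
    (hτ : ∀ p : MvPolynomial (Fin s) K, τ p =
      algebraMap (MvPolynomial (Fin s) K) (FractionRing (MvPolynomial (Fin s) K)) p ⊗ₜ[K] (1 : A)) :
    (∀ k : K, ι (algebraMap K A k) = τ (C k)) ∧
    (∀ q : MvPolynomial (Fin s) K, q ≠ 0 → IsUnit (τ q)) ∧
    Function.Injective (MvPolynomial.eval₂Hom ι (fun j : Fin s => τ (X j))) ∧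
    (∀ b : TensorProduct K (FractionRing (MvPolynomial (Fin s) K)) A,
      ∃ q : MvPolynomial (Fin s) K, q ≠ 0 ∧ ∃ F : MvPolynomial (Fin s) A,
        b * τ q = MvPolynomial.eval₂Hom ι (fun j : Fin s => τ (X j)) F) := by
  set Kt := MvPolynomial (Fin s) K
  set Ks := FractionRing (MvPolynomial (Fin s) K)
  set Φ : MvPolynomial (Fin s) A →+* TensorProduct K Ks A :=
    MvPolynomial.eval₂Hom ι (fun j : Fin s => τ (X j))
  have hΦC : ∀ r, Φ (C r) = ι r := fun r => eval₂Hom_C _ _ r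
  have hΦX : ∀ j, Φ (X j) = τ (X j) := fun j => eval₂Hom_X' _ _ j
  -- (1)
  have h1 : ∀ k : K, ι (algebraMap K A k) = τ (C k) := by
    intro k
    rw [hι, hτ]
    have e1 : algebraMap Kt Ks (C k) = algebraMap K Ks k := by
      change algebraMap Kt Ks (algebraMap K Kt k) = _
      rw [← IsScalarTower.algebraMap_apply]
    rw [e1, Algebra.algebraMap_eq_smul_one, Algebra.algebraMap_eq_smul_one, TensorProduct.tmul_smul,
      TensorProduct.smul_tmul']
  -- (2)
  have h2 : ∀ q : Kt, q ≠ 0 → IsUnit (τ q) := by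
    intro q hq
    rw [hτ]
    have h : algebraMap Kt Ks q ≠ 0 :=
      IsFractionRing.to_map_ne_zero_of_mem_nonZeroDivisors (mem_nonZeroDivisors_of_ne_zero hq)
    exact h.isUnit.map (Algebra.TensorProduct.includeLeftRingHom (R := K) (A := Ks) (B := A))
  -- (3)
  have h3 : Function.Injective Φ := by
    let f : Kt →ₐ[K] Ks := IsScalarTower.toAlgHom K Kt Ks
    have hf : Function.Injective f := IsFractionRing.injective Kt Ks
    let e₁ : MvPolynomial (Fin s) A ≃ₐ[A] A ⊗[K] Kt := (MvPolynomial.algebraTensorAlgEquiv K A).symm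
    let e₂ : A ⊗[K] Kt ≃ₐ[K] Kt ⊗[K] A := Algebra.TensorProduct.comm K A Kt
    let m : Kt ⊗[K] A →ₐ[K] Ks ⊗[K] A := Algebra.TensorProduct.map f (AlgHom.id K A)
    have hm : Function.Injective m := by
      have h := Module.Flat.rTensor_preserves_injective_linearMap (M := A) f.toLinearMap hf
      have hml : ∀ z, m z = f.toLinearMap.rTensor A z := by
        intro z
        induction z using TensorProduct.induction_on with
        | zero => simp
        | tmul p x => simp [m, LinearMap.rTensor_tmul]
        | add z₁ z₂ h₁ h₂ => rw [map_add, map_add, h₁, h₂]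
      intro z₁ z₂ hz
      exact h (by rw [← hml, ← hml]; exact hz)
    have he₁C : ∀ r : A, e₁ (C r) = r ⊗ₜ[K] 1 := by
      intro r
      rw [AlgEquiv.symm_apply_eq, MvPolynomial.algebraTensorAlgEquiv_tmul, map_one,
        MvPolynomial.smul_eq_C_mul, mul_one]
    have hcomp : Φ = (m.toRingHom.comp e₂.toRingHom).comp e₁.toRingHom := by
      refine MvPolynomial.ringHom_ext (fun r => ?_) (fun j => ?_)
      · rw [hΦC, hι]
        change _ = m (e₂ (e₁ (C r)))
        rw [he₁C, Algebra.TensorProduct.comm_tmul, Algebra.TensorProduct.map_tmul, map_one]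
        rfl
      · rw [hΦX, hτ]
        change _ = m (e₂ (e₁ (X j)))
        rw [show e₁ (X j) = 1 ⊗ₜ[K] X j from MvPolynomial.algebraTensorAlgEquiv_symm_X K A j,
          Algebra.TensorProduct.comm_tmul, Algebra.TensorProduct.map_tmul]
        rfl
    rw [hcomp]
    exact hm.comp (e₂.injective.comp e₁.injective)
  -- (4)
  have hΦmap : ∀ p : Kt, Φ (MvPolynomial.map (algebraMap K A) p) = τ p := by
    intro p
    suffices h : Φ.comp (MvPolynomial.map (algebraMap K A)) = τ from RingHom.congr_fun h p
    refine MvPolynomial.ringHom_ext (fun k => ?_) (fun j => ?_)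
    · change Φ (MvPolynomial.map _ (C k)) = τ (C k)
      rw [map_C, hΦC, h1]
    · change Φ (MvPolynomial.map _ (X j)) = τ (X j)
      rw [map_X, hΦX]
  have h4 : ∀ b : TensorProduct K Ks A, ∃ q : Kt, q ≠ 0 ∧ ∃ F : MvPolynomial (Fin s) A,
      b * τ q = Φ F := by
    intro b
    induction b using TensorProduct.induction_on with
    | zero => exact ⟨1, one_ne_zero, 0, by rw [zero_mul, map_zero]⟩
    | tmul k x =>
      obtain ⟨p, q, hq, rfl⟩ := IsFractionRing.div_surjective (A := Kt) k
      have hq0 : algebraMap Kt Ks q ≠ 0 := IsFractionRing.to_map_ne_zero_of_mem_nonZeroDivisors hq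
      refine ⟨q, nonZeroDivisors.ne_zero hq, C x * MvPolynomial.map (algebraMap K A) p, ?_⟩
      rw [map_mul, hΦC, hΦmap, hτ, hτ, hι, Algebra.TensorProduct.tmul_mul_tmul, mul_one,
        div_mul_cancel₀ _ hq0, Algebra.TensorProduct.tmul_mul_tmul, one_mul, mul_one]
    | add b₁ b₂ h₁ h₂ =>
      obtain ⟨q₁, hq₁, F₁, e₁⟩ := h₁
      obtain ⟨q₂, hq₂, F₂, e₂⟩ := h₂
      refine ⟨q₁ * q₂, mul_ne_zero hq₁ hq₂,
        F₁ * MvPolynomial.map (algebraMap K A) q₂ + F₂ * MvPolynomial.map (algebraMap K A) q₁, ?_⟩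
      rw [map_mul τ, map_add Φ, map_mul Φ, map_mul Φ, hΦmap, hΦmap, ← e₁, ← e₂]
      ring
  exact ⟨h1, h2, h3, h4⟩

end Tensor

/-! ## The chart ring after an abstract base change and the map `χ` -/

section Chart

variable (K A : Type u) [Field K] [CommRing A] [Algebra K A] (s : ℕ) (B : Type u) [CommRing B]
  (ι : A →+* B) (τ : MvPolynomial (Fin s) K →+* B)
  (hιτ : ∀ k : K, ι (algebraMap K A k) = τ (C k))
  (hΦ : Function.Injective (MvPolynomial.eval₂Hom ι (fun j : Fin s => τ (X j))))
  (hgenB : ∀ b : B, ∃ q : MvPolynomial (Fin s) K, q ≠ 0 ∧ ∃ F : MvPolynomial (Fin s) A,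
    b * τ q = MvPolynomial.eval₂Hom ι (fun j : Fin s => τ (X j)) F)
  (a : A) {I : Ideal A} (ha : a ∈ I)
  (χ : MvPolynomial (Fin s) (HomogeneousLocalization.Away (reesGrading I) (reesT a ha)) →+*
    blowupAlgebra (I.map ι) (ι a))
  (hχC : ∀ c, χ (C c) = blowupAlgebraMap ι I (I.map ι) a le_rfl (reesChartEquiv a ha c))
  (hχX : ∀ j, χ (X j) = algebraMap B (blowupAlgebra (I.map ι) (ι a)) (τ (X j)))

include hχC in
/-- `χ (r/1) = ι(r)/1`. [folklore] -/
theorem chartPolyMap_C_reesChartBase (r : A) :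
    χ (C (reesChartBase a ha r)) = algebraMap B (blowupAlgebra (I.map ι) (ι a)) (ι r) := by
  rw [hχC, reesChartEquiv_reesChartBase, blowupAlgebraMap_algebraMap]

omit [Algebra K A] in
include hχC hχX in
/-- `χ (F/1) = Φ(F)/1` for `F ∈ A[t]`. [folklore] -/
theorem chartPolyMap_map_reesChartBase (F : MvPolynomial (Fin s) A) :
    χ (MvPolynomial.map (reesChartBase a ha) F) =
      algebraMap B (blowupAlgebra (I.map ι) (ι a))
        (MvPolynomial.eval₂Hom ι (fun j : Fin s => τ (X j)) F) := by
  suffices h : χ.comp (MvPolynomial.map (reesChartBase a ha)) =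
      (algebraMap B (blowupAlgebra (I.map ι) (ι a))).comp
        (MvPolynomial.eval₂Hom ι (fun j : Fin s => τ (X j))) from RingHom.congr_fun h F
  refine MvPolynomial.ringHom_ext (fun r => ?_) (fun j => ?_)
  · rw [RingHom.comp_apply, RingHom.comp_apply, map_C,
      chartPolyMap_C_reesChartBase A s B ι a ha χ hχC, eval₂Hom_C]
  · rw [RingHom.comp_apply, RingHom.comp_apply, map_X, hχX, eval₂Hom_X']

include hιτ hχC hχX in
/-- `χ (p) = τ(p)/1` for `p ∈ K[t]` (scalars enter through `A`). [folklore] -/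
theorem chartPolyMap_jD (p : MvPolynomial (Fin s) K) :
    χ (MvPolynomial.map ((reesChartBase a ha).comp (algebraMap K A)) p) =
      algebraMap B (blowupAlgebra (I.map ι) (ι a)) (τ p) := by
  suffices h : χ.comp (MvPolynomial.map ((reesChartBase a ha).comp (algebraMap K A))) =
      (algebraMap B (blowupAlgebra (I.map ι) (ι a))).comp τ from RingHom.congr_fun h p
  refine MvPolynomial.ringHom_ext (fun k => ?_) (fun j => ?_)
  · rw [RingHom.comp_apply, RingHom.comp_apply, map_C, RingHom.comp_apply,
      chartPolyMap_C_reesChartBase A s B ι a ha χ hχC, hιτ]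
  · rw [RingHom.comp_apply, RingHom.comp_apply, map_X, hχX]

attribute [local instance] MvPolynomial.algebraMvPolynomial

omit [Algebra K A] in
include hΦ hχC hχX in
/-- **`χ` is injective**: inside `B[1/ι(a)]` it is the localization `A[1/a][t] → B[1/ι(a)]` of
the injective `Φ : A[t] → B` after the injective `(A[It])_{(at)}[t] → A[1/a][t]`. [folklore] -/
theorem chartPolyMap_injective : Function.Injective χ := by
  set Φ : MvPolynomial (Fin s) A →+* B := MvPolynomial.eval₂Hom ι (fun j : Fin s => τ (X j))
  have hΦC : ∀ r, Φ (C r) = ι r := fun r => eval₂Hom_C _ _ r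
  have hΦX : ∀ j, Φ (X j) = τ (X j) := fun j => eval₂Hom_X' _ _ j
  -- `A[1/a][t] → B[1/ι(a)]`, the localization of `Φ`
  let M : Submonoid (MvPolynomial (Fin s) A) := (Submonoid.powers a).map C
  have hM : M.map Φ = Submonoid.powers (ι a) := by
    change ((Submonoid.powers a).map C).map Φ = _
    rw [Submonoid.map_powers, Submonoid.map_powers, hΦC]
  haveI : IsLocalization (M.map Φ) (Localization.Away (ι a)) := by rw [hM]; infer_instance
  let δ : MvPolynomial (Fin s) (Localization.Away a) →+* Localization.Away (ι a) :=
    IsLocalization.map (Localization.Away (ι a)) Φ M.le_comap_map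
  have hδ : Function.Injective δ := IsLocalization.map_injective_of_injective M _ _ hΦ
  have hδmap : ∀ f : MvPolynomial (Fin s) A,
      δ (MvPolynomial.map (algebraMap A (Localization.Away a)) f) =
        algebraMap B (Localization.Away (ι a)) (Φ f) := fun f => IsLocalization.map_eq _ f
  have hδX : ∀ j, δ (X j) = algebraMap B (Localization.Away (ι a)) (τ (X j)) := by
    intro j
    have h := hδmap (X j)
    rwa [map_X, hΦX] at h
  have hδC : ∀ z, δ (C z) = Localization.awayMap ι a z := by
    intro z
    suffices h : δ.comp C = Localization.awayMap ι a from RingHom.congr_fun h z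
    refine IsLocalization.ringHom_ext (Submonoid.powers a) (RingHom.ext fun r => ?_)
    change δ (C (algebraMap A (Localization.Away a) r)) =
      Localization.awayMap ι a (algebraMap A (Localization.Away a) r)
    rw [← map_C (algebraMap A (Localization.Away a)) r, hδmap, hΦC, awayMap_algebraMap]
  -- `coe ∘ χ = δ ∘ map reesChart`
  have hcoe : (blowupAlgebra (I.map ι) (ι a)).val.toRingHom.comp χ =
      δ.comp (MvPolynomial.map (reesChart a ha)) := by
    refine MvPolynomial.ringHom_ext (fun c => ?_) (fun j => ?_)
    · change ((χ (C c) : blowupAlgebra (I.map ι) (ι a)) : Localization.Away (ι a)) =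
        δ (MvPolynomial.map (reesChart a ha) (C c))
      rw [hχC, map_C, hδC, coe_blowupAlgebraMap, coe_reesChartEquiv]
    · change ((χ (X j) : blowupAlgebra (I.map ι) (ι a)) : Localization.Away (ι a)) =
        δ (MvPolynomial.map (reesChart a ha) (X j))
      rw [hχX, map_X, hδX]
      rfl
  intro f g h
  have h' : δ (MvPolynomial.map (reesChart a ha) f) = δ (MvPolynomial.map (reesChart a ha) g) := by
    have e := fun x => RingHom.congr_fun hcoe x
    change (δ.comp (MvPolynomial.map (reesChart a ha))) f = (δ.comp (MvPolynomial.map (reesChart a ha))) g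
    rw [← e, ← e]
    exact congrArg (fun z : blowupAlgebra (I.map ι) (ι a) => (z : Localization.Away (ι a))) h
  exact MvPolynomial.map_injective _ (reesChart_injective a ha) (hδ h')

/-! ## Generation: `B[IB/ι(a)] = K(t) ⊗_K A[I/a]` -/

include hιτ hgenB hχC hχX in
/-- **`B[IB/ι(a)]` is generated by the image of `χ` and the inverses of the non-zero scalars of
`K[t]`**: every element `f` satisfies `f · χ(σ) = χ(d)` for some `0 ≠ σ ∈ K[t]`, `d` (check on
the generators `x/ι(a)`, `x ∈ IB`, and on `B`, and close under `+`, `·`). [folklore] -/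
theorem exists_mul_chartPolyMap_eq (f : blowupAlgebra (I.map ι) (ι a)) :
    ∃ σ : MvPolynomial (Fin s) K, σ ≠ 0 ∧ ∃ d,
      f * χ (MvPolynomial.map ((reesChartBase a ha).comp (algebraMap K A)) σ) = χ d := by
  set L := Localization.Away (ι a)
  set jD : MvPolynomial (Fin s) K →+*
      MvPolynomial (Fin s) (HomogeneousLocalization.Away (reesGrading I) (reesT a ha)) :=
    MvPolynomial.map ((reesChartBase a ha).comp (algebraMap K A))
  -- the predicate, on the ambient localization
  let P : L → Prop := fun z => ∃ σ : MvPolynomial (Fin s) K, σ ≠ 0 ∧ ∃ d,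
    z * ((χ (jD σ) : blowupAlgebra (I.map ι) (ι a)) : L) = ((χ d : blowupAlgebra (I.map ι) (ι a)) : L)
  have P_add : ∀ {z₁ z₂}, P z₁ → P z₂ → P (z₁ + z₂) := by
    rintro z₁ z₂ ⟨σ₁, hσ₁, d₁, e₁⟩ ⟨σ₂, hσ₂, d₂, e₂⟩
    refine ⟨σ₁ * σ₂, mul_ne_zero hσ₁ hσ₂, d₁ * jD σ₂ + d₂ * jD σ₁, ?_⟩
    simp only [map_mul, map_add, Subalgebra.coe_mul, Subalgebra.coe_add]
    rw [← e₁, ← e₂]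
    ring
  have P_mul : ∀ {z₁ z₂}, P z₁ → P z₂ → P (z₁ * z₂) := by
    rintro z₁ z₂ ⟨σ₁, hσ₁, d₁, e₁⟩ ⟨σ₂, hσ₂, d₂, e₂⟩
    refine ⟨σ₁ * σ₂, mul_ne_zero hσ₁ hσ₂, d₁ * d₂, ?_⟩
    simp only [map_mul, Subalgebra.coe_mul]
    rw [← e₁, ← e₂]
    ring
  have P_zero : P 0 := ⟨1, one_ne_zero, 0, by rw [zero_mul, map_zero, ZeroMemClass.coe_zero]⟩
  have P_base : ∀ b : B, P (algebraMap B L b) := by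
    intro b
    obtain ⟨q, hq, F, e⟩ := hgenB b
    refine ⟨q, hq, MvPolynomial.map (reesChartBase a ha) F, ?_⟩
    rw [chartPolyMap_jD K A s B ι τ hιτ a ha χ hχC hχX,
      chartPolyMap_map_reesChartBase K A s B ι τ a ha χ hχC hχX]
    change algebraMap B L b * algebraMap B L (τ q) = algebraMap B L _
    rw [← map_mul, e]
  have P_gen : ∀ x ∈ I.map ι, P (algebraMap B L x * IsLocalization.Away.invSelf (ι a)) := by
    intro x hx
    have hx' : x ∈ Submodule.span B (ι '' (I : Set A)) := hx
    refine Submodule.span_induction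
      (p := fun x _ => P (algebraMap B L x * IsLocalization.Away.invSelf (ι a))) ?_ ?_ ?_ ?_ hx'
    · rintro _ ⟨x, hxI, rfl⟩
      let y : blowupAlgebra I a := ⟨_, div_mem_blowupAlgebra I a hxI⟩
      refine ⟨1, one_ne_zero, C ((reesChartEquiv a ha).symm y), ?_⟩
      rw [map_one, map_one, OneMemClass.coe_one, mul_one, hχC, RingEquiv.apply_symm_apply,
        coe_blowupAlgebraMap]
      change _ = Localization.awayMap ι a
        (algebraMap A (Localization.Away a) x * IsLocalization.Away.invSelf a)
      rw [map_mul, awayMap_algebraMap, awayMap_invSelf]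
    · rw [map_zero, zero_mul]
      exact P_zero
    · intro x y _ _ hx hy
      rw [map_add, add_mul]
      exact P_add hx hy
    · intro b x _ hx
      rw [smul_eq_mul, map_mul, mul_assoc]
      exact P_mul (P_base b) hx
  have hf : (f : L) ∈ Algebra.adjoin B (blowupAlgebraGens (I.map ι) (ι a)) := f.2
  obtain ⟨σ, hσ, d, e⟩ : P (f : L) := by
    refine Algebra.adjoin_induction (p := fun z _ => P z) ?_ ?_ ?_ ?_ hf
    · rintro _ ⟨x, hx, rfl⟩
      exact P_gen x hx
    · intro b
      exact P_base b
    · intro z₁ z₂ _ _ h₁ h₂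
      exact P_add h₁ h₂
    · intro z₁ z₂ _ _ h₁ h₂
      exact P_mul h₁ h₂
  exact ⟨σ, hσ, d, Subtype.ext (by rw [Subalgebra.coe_mul]; exact e)⟩

end Chart

/-- **Registered form** (`stub_certificateRegularBaseChange`). For ring maps `ι : A → B`,
`τ : K[t₁, …, t_s] → B` with `ι = τ` on `K`, `Φ : A[t] → B` injective and `B = (K[t] ∖ 0)⁻¹ Φ(A[t])`
(e.g. `B = K(t) ⊗_K A`, `tensor_baseChange_hypotheses`), an ideal `I ∋ a` and the ring map
`χ : (A[It])_{(at)}[t] → B[IB/ι(a)]` with `χ(c) = (A[It])_{(at)} ≅ A[I/a] → B[IB/ι(a)]` on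
coefficients and `χ(t_j) = τ(t_j)/1`: `χ` is injective and every `f ∈ B[IB/ι(a)]` satisfies
`f · χ(σ) = χ(d)` for some non-zero scalar `σ ∈ K[t]` (blowing up commutes with the flat base
change `K → K(t)`). [cite: StacksProject, Tag 0805] -/
theorem stub_certificateRegularBaseChange (K A : Type) [Field K] [CommRing A] [Algebra K A] (s : ℕ) (B : Type) [CommRing B] (ι : A →+* B) (τ : MvPolynomial (Fin s) K →+* B) (hιτ : ∀ k : K, ι (algebraMap K A k) = τ (MvPolynomial.C k)) (hΦ : Function.Injective (MvPolynomial.eval₂Hom ι (fun j : Fin s => τ (MvPolynomial.X j)))) (hgenB : ∀ b : B, ∃ q : MvPolynomial (Fin s) K, q ≠ 0 ∧ ∃ F : MvPolynomial (Fin s) A, b * τ q = MvPolynomial.eval₂Hom ι (fun j : Fin s => τ (MvPolynomial.X j)) F) (I : Ideal A) (a : A) (ha : a ∈ I) (χ : MvPolynomial (Fin s) (HomogeneousLocalization.Away (Literature.AlgebraicGeometry.Resolution.reesGrading I) (Literature.AlgebraicGeometry.Resolution.reesT a ha)) →+* Literature.AlgebraicGeometry.Resolution.blowupAlgebra (I.map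 ι) (ι a)) (hχC : ∀ c, χ (MvPolynomial.C c) = Literature.AlgebraicGeometry.Resolution.blowupAlgebraMap ι I (I.map ι) a le_rfl (Literature.AlgebraicGeometry.Resolution.reesChartEquiv a ha c)) (hχX : ∀ j, χ (MvPolynomial.X j) = algebraMap B (Literature.AlgebraicGeometry.Resolution.blowupAlgebra (I.map ι) (ι a)) (τ (MvPolynomial.X j))) : Function.Injective χ ∧ ∀ f : Literature.AlgebraicGeometry.Resolution.blowupAlgebra (I.map ι) (ι a), ∃ σ : MvPolynomial (Fin s) K, σ ≠ 0 ∧ ∃ d, f * χ (MvPolynomial.map ((Literature.AlgebraicGeometry.Resolution.reesChartBase a ha).comp (algebraMap K A)) σ) = χ d :=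
  ⟨chartPolyMap_injective K A s B ι τ hΦ a ha χ hχC hχX,
    fun f => exists_mul_chartPolyMap_eq K A s B ι τ hιτ hgenB a ha χ hχC hχX f⟩

end Summit.ResolutionOfSingularities.ResolutionOfSingularities.Theorems.SectionAscent.CertificateRegular

end
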